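import Literature.AlgebraicGeometry.AbelianSchemes.PoincareSheafMulNKernel
import Literature.AlgebraicGeometry.AbelianSchemes.AbelianSchemeSteinOfNoetherian
import Literature.AlgebraicGeometry.RelativeSpec.PullbackIsoDiscrepancy
import HarnessLib

/-!
# The relative character pairing `e_n(g, L) ∈ Γ(S, 𝒪_S)` of an action over `[n]_A` with a line bundle killed by `[n]_A^*`,
# and its Poincaré instance `e_n(σ, c)` ([MumfordAV1970] §20; cell hodgecm-mathlib (h9-S) (S2) (W1b))

Layer `Literature/AlgebraicGeometry/AbelianSchemes`, namespace `Literature.AlgebraicGeometry.AbelianSchemes.AbelianSchemeOver.TorsionPairing`.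
THEOREMS ONLY (no definition, no named fact, no instance, no `sorry`).

Setting ([MumfordAV1970] §20 pp. 183–184, the `e_n`-pairing: for `L ∈ Pic⁰(X)` of order `n`, `n_X^* L ≅ 𝒪_X`, and the
translations by `X_n` act on this trivial bundle through a character): `A/S` an abelian scheme over a locally Noetherian base,
`ρ : ActionOver (A.mulN n).left K` an action of a group `K` on `A` OVER `[n]_A` (VARIABLE, as in ★ `TorsionTranslationCharacter`;
the translations by `n`-torsion sections are the case of interest), `L` a LINE BUNDLE on `A` and an isomorphism
`e : [n]^* L ≅ [n]^* 𝒪_A`.  The DISCREPANCY of `e` against the two canonical linearisations (★ `RelativeSpec.PullbackIsoDiscrepancy`: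
`σ_g^*(e) ≫ can⁰_g = can¹_g ≫ e ≫ (r_g · 𝟙)`, `r_g ∈ Γ(A, 𝒪_A)` unique) DESCENDS to the base: `r_g = [n]^♯ π^♯ c_g` for a unique
`c_g ∈ Γ(S, 𝒪_S)` (Stein, ★ `AbelianSchemeSteinOfNoetherian`), it is independent of `e`, multiplicative in `g`, and `c_g^n = 1`
when `g^n = 1` — the relative character pairing `e_n(g, L) := c_g`, DEF-FREE (it is the witness of an `∃!`).

* §1 `autHom_appTop_eq` (an action over `[n]` fixes the functions `[n]^♯ π^♯ c`), `existsUnique_pairingUnit` (existence and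
  uniqueness of `c_g ∈ Γ(S, 𝒪_S)`), `exists_pairingUnit_fun`, `pairingUnit_mul`, `pairingUnit_one`, `pairingUnit_pow_eq_one`;
* §2 INDEPENDENCE OF `e` (`pairingUnit_eq_of_iso`): two isomorphisms `e, e′ : [n]^*L ≅ [n]^*𝒪_A` differ by an automorphism of
  the trivial line bundle, i.e. by a global unit of `A`, which comes from `S` (Stein) — hence is pulled back from the base of
  `[n]`, and ★ `discrepancy_conj` applies;
* §3 THE POINCARÉ INSTANCE: for a dual pair `D = (Â, 𝒫)` with the unit hypothesis, a base change `f : T → S` and an `n`-torsion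
  `T`-point `c` of `Â`, the line bundle `L_c := (1 × c)^*𝒫` on `A_T` has `[n]^* L_c ≅ 𝒪` (★ (K1) `PoincareSheafMulNKernel`), so
  every action `ρ` over `[n]_{A_T}` has its pairing units `e_n(g, c) ∈ Γ(T, 𝒪_T)` (`exists_poincarePairingUnit_fun`, with
  `^n = 1` on `n`-torsion `g` and multiplicativity in `g`).

NOT here (sequels): multiplicativity in `c` (★ biadditivity of `𝒫`), base change of `e_n` along `T′ → T` (★ `discrepancy_restrict`),
the identification at a geometric point with ★ `weilPairingLevel Θ` under `IsLambdaOfAt` ((h9-S) (W2)), the transport (W3).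

Cell hodgecm-mathlib (D-0151), F-DAG (h9) symplectic half (S2) road (W1) (census `B-provers/B-p13/g18/CENSUS-h9S-LevelTransport`;
B-p03 (g16) 03:13:50Z fit; B-plan1 (g15) 03:24:17Z).  Count-neutral capital (brick 1 of the Cartier duality `A[n] × Â[n] → μ_n`
over a base); HC_CM is proved only modulo the 7 printed citations until rung 0 closes — nothing here is about HC.

## References
* [MumfordAV1970] D. Mumford, *Abelian Varieties* (1970), §7 Prop. 2 (p. 70), §12 Thm. 1 (p. 112), §15 Thm. 1 (p. 143), §20
  (pp. 183–185).
* [MilneAV2008] J. S. Milne, *Abelian Varieties* (2008), I §11 (the `e_m`-pairing), I §8 (pp. 36–37).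
* Tree: ★ `RelativeSpec.PullbackIsoDiscrepancy` (`existsUnique_discrepancy`, `discrepancy_conj`, `discrepancy_one`, `discrepancy_mul`,
  `discrepancy_pow_eq_one`), ★ `Modules.RankOneEndomorphismScalar` (`exists_unique_eq_globalScalar`, `eq_of_globalScalar_eq`),
  ★ `Modules.LinearOverBase` (`globalScalar`), ★ `PullbackClosedImmersionCokernel.pullback_map_globalScalar`, ★
  `AbelianSchemeSteinOfNoetherian` (`app_bijective_of_isLocallyNoetherian`), ★ (K1) `PoincareSheafMulNKernel`; companion ★
  `TorsionTranslationCharacter` (the same pairing in the eigen-section currency).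
-/

set_option autoImplicit false

noncomputable section

-- `TopCat.Presheaf`/`Scheme.Modules` are not reducible (as in Mathlib's `AlgebraicGeometry/Modules`).
set_option backward.isDefEq.respectTransparency false

universe u

open CategoryTheory CategoryTheory.Limits AlgebraicGeometry MonoidalCategory CartesianMonoidalCategory TopologicalSpace
  Opposite
open scoped MonObj

namespace Literature.AlgebraicGeometry.AbelianSchemes.AbelianSchemeOver.TorsionPairing

open Literature.AlgebraicGeometry.RelativeSpec Literature.AlgebraicGeometry.Modules Literature.AlgebraicGeometry.Motives
  Literature.AlgebraicGeometry.HodgeTheory Literature.AlgebraicGeometry.Morphisms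
  Literature.AlgebraicGeometry.RelativeSpec.ActionOver

variable {S : Scheme.{u}} (A : AbelianSchemeOver S) {K : Type u} [Group K] {n : ℕ}
  (ρ : ActionOver (A.mulN n).left K) (L : A.X.left.Modules)
  (e : (Scheme.Modules.pullback (A.mulN n).left).obj L ≅
    (Scheme.Modules.pullback (A.mulN n).left).obj (SheafOfModules.unit A.X.left.ringCatSheaf))

/-! ## §1 The discrepancy descends to the base: the pairing unit `c_g ∈ Γ(S, 𝒪_S)` -/

/-- Global functions of `A` come from `S` (Stein, ★ `app_bijective_of_isLocallyNoetherian`), `[n]`-spelling: `r = [n]^♯ π^♯ c`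
(a copy of ★ `MulNCharacter.exists_app_eq_of_isLocallyNoetherian` at `Γ(A, ⊤)`, kept local to spare the import).
[cite: GortzWedhorn2023, Cor. 24.63 (p. 404)] -/
private theorem exists_appTop_eq [IsLocallyNoetherian S] (r : Γ(A.X.left, ⊤)) :
    ∃ c : Γ(S, ⊤), r = (A.mulN n).left.appTop (A.X.hom.appTop c) := by
  obtain ⟨c, hc⟩ := (A.app_bijective_of_isLocallyNoetherian ⊤).2 (show Γ(A.X.left, A.X.hom ⁻¹ᵁ ⊤) from r)
  refine ⟨c, ?_⟩
  have hw : (A.mulN n).left ≫ A.X.hom = A.X.hom := Over.w (A.mulN n)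
  change r = (A.X.hom.appTop ≫ (A.mulN n).left.appTop) c
  rw [← Scheme.Hom.comp_appTop, hw]
  exact hc.symm

/-- `c ↦ [n]^♯ π^♯ c` is injective (Stein). [cite: GortzWedhorn2023, Cor. 24.63 (p. 404)] -/
private theorem appTop_appTop_inj [IsLocallyNoetherian S] :
    Function.Injective fun c : Γ(S, ⊤) => (A.mulN n).left.appTop (A.X.hom.appTop c) := by
  have hw : (A.mulN n).left ≫ A.X.hom = A.X.hom := Over.w (A.mulN n)
  intro c c' h
  apply (A.app_bijective_of_isLocallyNoetherian ⊤).1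
  change (A.X.hom.appTop) c = (A.X.hom.appTop) c'
  rw [← hw, Scheme.Hom.comp_appTop]
  exact h


/-- `[n]^* 𝒪_A` is a line bundle. [cite: MumfordAV1970, §20 (p. 184)] -/
theorem hasRank_pullback_unit :
    HasRank ((Scheme.Modules.pullback (A.mulN n).left).obj (SheafOfModules.unit A.X.left.ringCatSheaf)) 1 :=
  hasRank_pullback _ hasRank_unitModule

/-- **An action over `[n]_A` fixes the functions coming from the base**: `σ_g^♯ ([n]^♯ π^♯ c) = [n]^♯ π^♯ c` (`σ_g ≫ [n] = [n]`).
[cite: MumfordAV1970, §7 Prop. 2 (p. 70)] -/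
theorem autHom_appTop_eq (g : K) (c : Γ(S, ⊤)) :
    (ρ.autHom g).appTop ((A.mulN n).left.appTop (A.X.hom.appTop c)) = (A.mulN n).left.appTop (A.X.hom.appTop c) := by
  change (((A.mulN n).left.appTop ≫ (ρ.autHom g).appTop) (A.X.hom.appTop c)) = _
  rw [← Scheme.Hom.comp_appTop, ρ.autHom_comp]

/-- **EXISTENCE AND UNIQUENESS OF THE PAIRING UNIT**: for a line bundle `L` on `A` with `e : [n]^* L ≅ [n]^* 𝒪_A` and `g ∈ K`
there is a unique `c ∈ Γ(S, 𝒪_S)` with `σ_g^*(e) ≫ can⁰_g = can¹_g ≫ e ≫ ([n]^♯ π^♯ c · 𝟙)` — the discrepancy of `e` at `g`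
(★ `existsUnique_discrepancy`) read in `Γ(S, 𝒪_S) = Γ(A, 𝒪_A)` (Stein). [MumfordAV1970] §20 p. 184: «`e_n(x, L)`».
[cite: MumfordAV1970, §20 (p. 184)] [cite: MumfordAV1970, §12 Thm. 1 (p. 112)] -/
theorem existsUnique_pairingUnit [IsLocallyNoetherian S] (g : K) :
    ∃! c : Γ(S, ⊤), (Scheme.Modules.pullback (ρ.autHom g)).map e.hom ≫
        ((EquivariantStructure.ofPullback ρ (SheafOfModules.unit A.X.left.ringCatSheaf)).iso g).hom =
      ((EquivariantStructure.ofPullback ρ L).iso g).hom ≫ e.hom ≫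
        globalScalar _ ((A.mulN n).left.appTop (A.X.hom.appTop c)) := by
  obtain ⟨r, hr, huniq⟩ := existsUnique_discrepancy ρ _ L e (hasRank_pullback_unit A) g
  obtain ⟨c, hc⟩ := exists_appTop_eq A (n := n) r
  refine ⟨c, ?_, fun c' hc' => ?_⟩
  · beta_reduce
    rw [← hc]
    exact hr
  · exact appTop_appTop_inj A (n := n) ((huniq _ hc').trans hc)

/-- A FUNCTION of pairing units `g ↦ c_g` exists. [cite: MumfordAV1970, §20 (p. 184)] -/
theorem exists_pairingUnit_fun [IsLocallyNoetherian S] :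
    ∃ c : K → Γ(S, ⊤), ∀ g : K, (Scheme.Modules.pullback (ρ.autHom g)).map e.hom ≫
        ((EquivariantStructure.ofPullback ρ (SheafOfModules.unit A.X.left.ringCatSheaf)).iso g).hom =
      ((EquivariantStructure.ofPullback ρ L).iso g).hom ≫ e.hom ≫
        globalScalar _ ((A.mulN n).left.appTop (A.X.hom.appTop (c g))) :=
  ⟨fun g => (existsUnique_pairingUnit A ρ L e g).choose, fun g => (existsUnique_pairingUnit A ρ L e g).choose_spec.1⟩

section Fun

variable (c : K → Γ(S, ⊤))
  (hc : ∀ g : K, (Scheme.Modules.pullback (ρ.autHom g)).map e.hom ≫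
        ((EquivariantStructure.ofPullback ρ (SheafOfModules.unit A.X.left.ringCatSheaf)).iso g).hom =
      ((EquivariantStructure.ofPullback ρ L).iso g).hom ≫ e.hom ≫
        globalScalar _ ((A.mulN n).left.appTop (A.X.hom.appTop (c g))))

include hc in
/-- **Multiplicativity `c_{gh} = c_g · c_h`** — the pairing unit is a homomorphism `K → Γ(S, 𝒪_S)^×` (★ `discrepancy_mul`; the
discrepancies `[n]^♯ π^♯ c_g` are invariant under the action, `autHom_appTop_eq`). [cite: MumfordAV1970, §20 (p. 184)] -/
theorem pairingUnit_mul [IsLocallyNoetherian S] (g h : K) : c (g * h) = c g * c h := by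
  have hm := discrepancy_mul ρ _ L e (hasRank_pullback_unit A) (fun g => (A.mulN n).left.appTop (A.X.hom.appTop (c g))) hc
    (fun g h => autHom_appTop_eq A ρ h (c g)) g h
  apply appTop_appTop_inj A (n := n)
  change (A.mulN n).left.appTop (A.X.hom.appTop (c (g * h))) = (A.mulN n).left.appTop (A.X.hom.appTop (c g * c h))
  rw [map_mul, map_mul]
  exact hm

include hc in
/-- **`c_1 = 1`** (★ `discrepancy_one`). [cite: MumfordAV1970, §20 (p. 184)] -/
theorem pairingUnit_one [IsLocallyNoetherian S] : c 1 = 1 := by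
  have h1 := discrepancy_one ρ _ L e (hasRank_pullback_unit A) (fun g => (A.mulN n).left.appTop (A.X.hom.appTop (c g))) hc
  apply appTop_appTop_inj A (n := n)
  change (A.mulN n).left.appTop (A.X.hom.appTop (c 1)) = (A.mulN n).left.appTop (A.X.hom.appTop 1)
  rw [map_one, map_one]
  exact h1

include hc in
/-- **`c_g^n = 1` for `g^n = 1`** — the pairing unit of an `n`-torsion element is an `n`-th root of unity in `Γ(S, 𝒪_S)`
(★ `discrepancy_pow_eq_one`). [cite: MumfordAV1970, §20 (p. 184)] -/
theorem pairingUnit_pow_eq_one [IsLocallyNoetherian S] {g : K} (hg : g ^ n = 1) : c g ^ n = 1 := by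
  have hp := discrepancy_pow_eq_one ρ _ L e (hasRank_pullback_unit A) (fun g => (A.mulN n).left.appTop (A.X.hom.appTop (c g)))
    hc (fun g h => autHom_appTop_eq A ρ h (c g)) hg
  apply appTop_appTop_inj A (n := n)
  change (A.mulN n).left.appTop (A.X.hom.appTop (c g ^ n)) = (A.mulN n).left.appTop (A.X.hom.appTop 1)
  rw [map_pow, map_pow, map_one, map_one]
  exact hp

end Fun

/-! ## §2 Independence of the isomorphism `e` -/

/-- **An automorphism of the line bundle `[n]^* 𝒪_A` is a global unit of `A`, hence pulled back from the base of `[n]`**: it is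
`[n]^*(v · 𝟙_{𝒪_A})` for a unit `v ∈ Γ(A, 𝒪_A)` (★ `exists_unique_eq_globalScalar`, Stein `Γ(A, 𝒪_A) = Γ(S, 𝒪_S)`, ★
`pullback_map_globalScalar`). [cite: MumfordAV1970, §12 Thm. 1 (p. 112)] -/
theorem exists_iso_eq_pullback_mapIso [IsLocallyNoetherian S]
    (u : (Scheme.Modules.pullback (A.mulN n).left).obj (SheafOfModules.unit A.X.left.ringCatSheaf) ≅
      (Scheme.Modules.pullback (A.mulN n).left).obj (SheafOfModules.unit A.X.left.ringCatSheaf)) :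
    ∃ j : SheafOfModules.unit A.X.left.ringCatSheaf ≅ SheafOfModules.unit A.X.left.ringCatSheaf,
      u = (Scheme.Modules.pullback (A.mulN n).left).mapIso j := by
  -- `u = a · 𝟙`, `u⁻¹ = b · 𝟙` with `b a = 1`
  obtain ⟨a, ha, -⟩ := exists_unique_eq_globalScalar (hasRank_pullback_unit A) u.hom
  obtain ⟨b, hb, -⟩ := exists_unique_eq_globalScalar (hasRank_pullback_unit A) u.inv
  have hba : b * a = 1 := by
    apply eq_of_globalScalar_eq Nat.one_pos (hasRank_pullback_unit A (n := n))
    rw [globalScalar_mul, globalScalar_one, ← ha, ← hb, u.hom_inv_id]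
  -- `a = [n]^♯ π^♯ a₀`, `b = [n]^♯ π^♯ b₀`, `b₀ a₀ = 1`
  obtain ⟨a₀, ha₀⟩ := exists_appTop_eq A (n := n) a
  obtain ⟨b₀, hb₀⟩ := exists_appTop_eq A (n := n) b
  have h1 : b₀ * a₀ = 1 := by
    apply appTop_appTop_inj A (n := n)
    change (A.mulN n).left.appTop (A.X.hom.appTop (b₀ * a₀)) = (A.mulN n).left.appTop (A.X.hom.appTop 1)
    rw [map_mul, map_mul, map_one, map_one]
    exact ((congrArg₂ (· * ·) hb₀ ha₀).symm.trans hba :)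
  have h2 : a₀ * b₀ = 1 := by rw [mul_comm]; exact h1
  refine ⟨⟨globalScalar _ (A.X.hom.appTop a₀), globalScalar _ (A.X.hom.appTop b₀), ?_, ?_⟩, ?_⟩
  · rw [← globalScalar_mul, ← map_mul, h1, map_one, globalScalar_one]
  · rw [← globalScalar_mul, ← map_mul, h2, map_one, globalScalar_one]
  · ext : 1
    change u.hom = (Scheme.Modules.pullback (A.mulN n).left).map (globalScalar _ (A.X.hom.appTop a₀))
    rw [pullback_map_globalScalar, ha]
    exact congrArg _ ha₀

/-- **INDEPENDENCE OF `e`**: two isomorphisms `e, e′ : [n]^* L ≅ [n]^* 𝒪_A` have the same pairing units (`e′ = e ≫ u` with `u`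
an automorphism of `[n]^*𝒪_A`, pulled back from the base by `exists_iso_eq_pullback_mapIso`; ★ `discrepancy_conj`).  So `c_g`
is an invariant `e_n(g, L)` of `(ρ, g, L)`. [cite: MumfordAV1970, §20 (p. 184)] -/
theorem pairingUnit_eq_of_iso [IsLocallyNoetherian S]
    (e' : (Scheme.Modules.pullback (A.mulN n).left).obj L ≅
      (Scheme.Modules.pullback (A.mulN n).left).obj (SheafOfModules.unit A.X.left.ringCatSheaf))
    (g : K) (c c' : Γ(S, ⊤))
    (hc : (Scheme.Modules.pullback (ρ.autHom g)).map e.hom ≫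
        ((EquivariantStructure.ofPullback ρ (SheafOfModules.unit A.X.left.ringCatSheaf)).iso g).hom =
      ((EquivariantStructure.ofPullback ρ L).iso g).hom ≫ e.hom ≫
        globalScalar _ ((A.mulN n).left.appTop (A.X.hom.appTop c)))
    (hc' : (Scheme.Modules.pullback (ρ.autHom g)).map e'.hom ≫
        ((EquivariantStructure.ofPullback ρ (SheafOfModules.unit A.X.left.ringCatSheaf)).iso g).hom =
      ((EquivariantStructure.ofPullback ρ L).iso g).hom ≫ e'.hom ≫
        globalScalar _ ((A.mulN n).left.appTop (A.X.hom.appTop c'))) :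
    c = c' := by
  -- `e′ = e ≫ [n]^* j`
  obtain ⟨j, hj⟩ := exists_iso_eq_pullback_mapIso A (n := n) (e.symm ≪≫ e')
  have he' : e' = (Scheme.Modules.pullback (A.mulN n).left).mapIso (Iso.refl L) ≪≫ e ≪≫
      (Scheme.Modules.pullback (A.mulN n).left).mapIso j := by
    rw [← hj, Functor.mapIso_refl, Iso.refl_trans, Iso.self_symm_id_assoc]
  have hconj := discrepancy_conj ρ _ L e j (Iso.refl L) ((A.mulN n).left.appTop (A.X.hom.appTop c)) g hc
  rw [← he'] at hconj
  exact (existsUnique_pairingUnit A ρ L e' g).unique hconj hc'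

/-! ## §3 The Poincaré instance: `L_c = (1 × c)^*𝒫` for an `n`-torsion point `c` of the dual -/

section Poincare

variable {A} (D : A.DualPair) {T : Scheme.{u}} (f : T ⟶ S)

/-- `[n]^* 𝒪 ≅ 𝒪` for the pull-back of the structure sheaf along `[n]_{A_T}` (the functor `U ↦ [n]⁻¹U` on opens is final).
[cite: Hartshorne1977, II §5 p. 110 (f^*𝒪_Y = 𝒪_X)] -/
theorem nonempty_pullback_mulN_unit_iso_unit :
    Nonempty ((Scheme.Modules.pullback ((A.baseChange f).mulN n).left).obj
        (SheafOfModules.unit (A.baseChange f).X.left.ringCatSheaf) ≅ SheafOfModules.unit (A.baseChange f).X.left.ringCatSheaf) := by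
  have hI : IsIso (SheafOfModules.pullbackObjUnitToUnit ((A.baseChange f).mulN n).left.toRingCatSheafHom) := by
    haveI := Literature.AlgebraicGeometry.KTheory.final_opensMap ((A.baseChange f).mulN n).left
    exact SheafOfModules.instIsIsoPullbackObjUnitToUnitOfFinal _
  exact ⟨@asIso _ _ _ _ (SheafOfModules.pullbackObjUnitToUnit ((A.baseChange f).mulN n).left.toRingCatSheafHom) hI⟩

/-- **`[n]^* L_c ≅ [n]^* 𝒪` for the line bundle `L_c = (1 × c)^*𝒫` of an `n`-torsion `T`-point `c` of `Â`** (★ (K1)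
`nonempty_pullback_mulN_pullbackP_iso_unit_of_pow_eq_one` composed with `[n]^*𝒪 ≅ 𝒪`): the input `e` of §1–§2 for the
abelian scheme `A_T/T`.  [MumfordAV1970] §20 p. 184 («`n_X^* L` is trivial for `L ∈ Pic⁰` of order `n`»).
[cite: MumfordAV1970, §20 (p. 184)] [cite: MumfordAV1970, §8 ((iv), p. 75)] -/
theorem nonempty_pullback_mulN_pullbackP_iso_pullback_unit [IsReduced S] [IsLocallyNoetherian S]
    (hD : Nonempty ((Scheme.Modules.pullback (DualPair.unitHatSlice D)).obj D.P ≅ SheafOfModules.unit _))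
    (c : Over.mk f ⟶ D.hat.X) (hc : c ^ n = 1) :
    Nonempty ((Scheme.Modules.pullback ((A.baseChange f).mulN n).left).obj (D.pullbackP f c.left (Over.w c)) ≅
      (Scheme.Modules.pullback ((A.baseChange f).mulN n).left).obj
        (SheafOfModules.unit (A.baseChange f).X.left.ringCatSheaf)) := by
  obtain ⟨τ⟩ := D.nonempty_pullback_mulN_pullbackP_iso_unit_of_pow_eq_one f hD c n hc
  obtain ⟨u⟩ := nonempty_pullback_mulN_unit_iso_unit (n := n) (A := A) f
  exact ⟨τ ≪≫ u.symm⟩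

/-- `L_c = (1 × c)^*𝒫` is a line bundle. [cite: MumfordAV1970, §8 ((iv), p. 75)] -/
theorem hasRank_pullbackP (c : Over.mk f ⟶ D.hat.X) : HasRank (D.pullbackP f c.left (Over.w c)) 1 :=
  hasRank_pullback _ D.hasRank_one

/-- **THE PAIRING UNITS `e_n(g, c) ∈ Γ(T, 𝒪_T)` EXIST** for every action `ρ` of a group `K` on `A_T` over `[n]_{A_T}` (e.g. the
translations by a finite group of `n`-torsion sections of `A_T`) and every `n`-torsion `T`-point `c` of `Â`: a function
`g ↦ e_n(g, c)` with the discrepancy equations for ONE (hence, §2, every) trivialisation of `[n]^* L_c`; it is a homomorphism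
(`pairingUnit_mul`, `pairingUnit_one`) with values in `μ_n(Γ(T, 𝒪_T))` on `n`-torsion `g` (`pairingUnit_pow_eq_one`).
[cite: MumfordAV1970, §20 (p. 184)] -/
theorem exists_poincarePairingUnit_fun [IsReduced S] [IsLocallyNoetherian S] [IsLocallyNoetherian T]
    (hD : Nonempty ((Scheme.Modules.pullback (DualPair.unitHatSlice D)).obj D.P ≅ SheafOfModules.unit _))
    (c : Over.mk f ⟶ D.hat.X) (hc : c ^ n = 1) {K : Type u} [Group K] (ρ : ActionOver ((A.baseChange f).mulN n).left K) :
    ∃ (e : (Scheme.Modules.pullback ((A.baseChange f).mulN n).left).obj (D.pullbackP f c.left (Over.w c)) ≅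
        (Scheme.Modules.pullback ((A.baseChange f).mulN n).left).obj
          (SheafOfModules.unit (A.baseChange f).X.left.ringCatSheaf))
      (u : K → Γ(T, ⊤)), ∀ g : K, (Scheme.Modules.pullback (ρ.autHom g)).map e.hom ≫
        ((EquivariantStructure.ofPullback ρ (SheafOfModules.unit (A.baseChange f).X.left.ringCatSheaf)).iso g).hom =
      ((EquivariantStructure.ofPullback ρ (D.pullbackP f c.left (Over.w c))).iso g).hom ≫ e.hom ≫
        globalScalar _ (((A.baseChange f).mulN n).left.appTop ((A.baseChange f).X.hom.appTop (u g))) := by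
  obtain ⟨e⟩ := nonempty_pullback_mulN_pullbackP_iso_pullback_unit (n := n) D f hD c hc
  obtain ⟨u, hu⟩ := exists_pairingUnit_fun (A.baseChange f) ρ _ e
  exact ⟨e, u, hu⟩

end Poincare

end Literature.AlgebraicGeometry.AbelianSchemes.AbelianSchemeOver.TorsionPairing

end
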